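import Summits.KontsevichZagierPeriods.KontsevichZagierPeriods.Theorems.SoloBlindZigzag
import Summits.KontsevichZagierPeriods.KontsevichZagierPeriods.Theorems.SoloBlindZetaTwoSquare
import Literature.Analysis.SpecialFunctions.SelbergLimit
import HarnessLib

/-!
# The angle box `[(0,1)⁴, w]` and its dissection into order cells

With `tᵢ = tan(θᵢ/2)` the angle volume form on `(0, π/2)⁴` is `w(t) dt = ∏ᵢ 2dtᵢ/(1+tᵢ²)`
on the open box `(0,1)⁴`.  The **angle box** `[(0,1)⁴, w]` is the fourth power of the open
angle cell `[(0,1), 2dt/(1+t²)]` (rule: products), whose class in the period ring `Q` of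
`SoloBlindBoxRing` is `2·a(1)` (`a(1) = [A(1;1)]`, `x_π = 4·a(1)`), so that
`[(0,1)⁴, w] = (2·a(1))⁴ = x_π⁴/16` (`mkQ_angleBox`).

Pieces `[E, w]` of the angle box (`anglePiece`) carry the tangent cell `T`, its half `T₊`, the
zigzag cell `O` and the ordered simplex `Δ`; the transfer move of `SoloBlindZigzag` reads
`[O, w] ≡ [T₊, w]` (`zigPiece_equiv_tanHalfPiece`).  Finally the dissection of the box by the
coordinate hyperplanes (rule (1); ties are Lebesgue-null, and a strictly decreasing
rearrangement of a point is unique) gives **`[(0,1)⁴, w] = Σ_{σ ∈ S₄} [Δ_σ, w] = 24·[Δ, w]`**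
(`mkQ_angleBox_eq`; `w` is symmetric and each `Δ_σ` is a coordinate permutation of `Δ`).
-/

noncomputable section

namespace Summit.KontsevichZagierPeriods.KontsevichZagierPeriods.Theorems

open Set MeasureTheory
open Literature.ModelTheory.ExponentialFields (IsSemialgebraic isSemialgebraic_setOf_eval_pos)
open MvPolynomial (aeval X C)
open Literature.NumberTheory.Transcendental
open Literature.NumberTheory.Transcendental.KZ

namespace SoloBlind

/-! ## The angle cell and the angle box -/

/-- The closed unit angle cell `A(2; 1) = [[0,1], 2/(1+t²)]` (`θ = 2 arctan t`; value `π/2`). -/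
def angleCell : IntegralRep 1 := atanCell ((2 : K₀) : ℝ) 1 (K₀.isAlgebraic 2) isAlgebraic_one

/-- `[A(2;1)] = 2·a(1)` in `Q`. -/
theorem mkQ_angleCell : mkQ (of angleCell) = (2 : K₀) • alpha 1 := by
  unfold angleCell
  simpa only [Subtype.coe_eta] using mkQ_atanCell (K₀.isAlgebraic 2) isAlgebraic_one

/-- The integrand of the angle cell is `W(x₀) = 2/(1+x₀²)`. -/
theorem angleCell_integrand : angleCell.integrand = fun x => tW (x 0) := by
  funext x
  show ((2 : K₀) : ℝ) / (1 + x 0 ^ 2) = tW (x 0)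
  have h2 : ((2 : K₀) : ℝ) = 2 := by norm_cast
  rw [h2]
  rfl

/-- The open angle cell `[(0,1), 2/(1+t²)]` (the endpoints, a null set, removed). -/
def angleCellO : IntegralRep 1 :=
  angleCell.restrict (line (Ioo 0 1)) (isSemialgebraic_line_Ioo isAlgebraic_zero isAlgebraic_one)
    fun _ hx => Ioo_subset_Icc_self hx

/-- Removing the endpoints is a move: `[A(2;1)] − [(0,1), 2/(1+t²)] ∈ relations`. -/
theorem angleCell_sub_angleCellO : of angleCell - of angleCellO ∈ relations := by
  refine IntegralRep.of_sub_of_restrict_mem_relations _ _ _ ?_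
  show volume (line (Icc (0 : ℝ) 1 \ Ioo 0 1)) = 0
  rw [volume_line, Icc_sdiff_Ioo_same zero_le_one]
  exact (toFinite _).measure_zero _

/-- `[(0,1), 2/(1+t²)] = 2·a(1)` in `Q`. -/
theorem mkQ_angleCellO : mkQ (of angleCellO) = (2 : K₀) • alpha 1 := by
  rw [← mkQ_angleCell, eq_comm, mkQ_eq_mkQ_iff]
  exact angleCell_sub_angleCellO

/-- **The angle box** `[(0,1)⁴, w]`: the fourth power of the open angle cell. -/
def angleBox : IntegralRep 4 := ((angleCellO.prod angleCellO).prod angleCellO).prod angleCellO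

/-- The domain of the angle box is the open box `(0,1)⁴`. -/
theorem angleBox_domain : angleBox.domain = kzOpenBox 4 := by
  ext z
  simp only [angleBox, angleCellO, IntegralRep.prod_domain, mem_kzOpenBox]
  constructor
  · rintro ⟨⟨⟨h0, h1⟩, h2⟩, h3⟩ i
    fin_cases i
    · exact h0
    · exact h1
    · exact h2
    · exact h3
  · intro h
    exact ⟨⟨⟨h _, h _⟩, h _⟩, h _⟩

/-- The integrand of the angle box is the angle weight `w(t) = ∏ᵢ 2/(1+tᵢ²)`. -/
theorem angleBox_integrand : angleBox.integrand = tanWeight := by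
  funext z
  simp only [angleBox, angleCellO, IntegralRep.prod_integrand_eq, IntegralRep.prodFun_apply,
    IntegralRep.integrand_restrict, angleCell_integrand, tanWeight_eq, Fin.prod_univ_four]
  rfl

/-- **`[(0,1)⁴, w] = (2·a(1))⁴` in `Q`** (rule: products). -/
theorem mkQ_angleBox : mkQ (of angleBox) = ((2 : K₀) • alpha 1) ^ 4 := by
  rw [angleBox, ← of_mul_of, ← of_mul_of, ← of_mul_of, mkQ_mul, mkQ_mul, mkQ_mul, mkQ_angleCellO]
  ring

/-! ## Pieces of the angle box -/

section piece

variable (E : Set (Fin 4 → ℝ)) (hE : IsSemialgebraic ℚ E) (hsub : E ⊆ kzOpenBox 4)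

/-- The piece `[E, w]` of the angle box over a `ℚ`-semialgebraic `E ⊆ (0,1)⁴`. -/
def anglePiece : IntegralRep 4 := angleBox.restrict E hE (by rw [angleBox_domain]; exact hsub)

/-- The domain of a piece. -/
@[simp] theorem anglePiece_domain : (anglePiece E hE hsub).domain = E := rfl

/-- The integrand of a piece is `w`. -/
@[simp] theorem anglePiece_integrand : (anglePiece E hE hsub).integrand = tanWeight :=
  angleBox_integrand

end piece

/-- `Δ₄ ⊆ (0,1)⁴`. -/
theorem openOrderedSimplex_subset_kzOpenBox : openOrderedSimplex 4 ⊆ kzOpenBox 4 :=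
  fun _ ht i => ⟨ht.1 i, ht.2.1 i⟩

/-- `[T, w]`: the tangent cell with the angle weight. -/
def tanPiece : IntegralRep 4 := anglePiece tanCell isSemialgebraic_tanCell tanCell_subset_kzOpenBox

/-- `[T₊, w]`. -/
def tanHalfPiece : IntegralRep 4 :=
  anglePiece tanHalfCell isSemialgebraic_tanHalfCell
    (tanHalfCell_subset.trans tanCell_subset_kzOpenBox)

/-- `[O, w]`. -/
def zigPiece : IntegralRep 4 := anglePiece zigCell isSemialgebraic_zigCell zigCell_subset_kzOpenBox

/-- `[Δ, w]`: the open ordered simplex with the angle weight. -/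
def simplexPiece : IntegralRep 4 :=
  anglePiece (openOrderedSimplex 4) (isSemialgebraic_openOrderedSimplex 4)
    openOrderedSimplex_subset_kzOpenBox

/-- **Transfer (rule (2))**: `[O, w] ≡ [T₊, w]`. -/
theorem zigPiece_equiv_tanHalfPiece : Equivalent zigPiece tanHalfPiece :=
  equivalent_of_zigChart rfl (fun s _ => by simp [zigPiece]) rfl fun t _ => by simp [tanHalfPiece]

/-! ## Dissection of the box into the `24` order cells (ties are null: `SelbergLimit`) -/

/-- The order cell `Δ_σ = {t | t ∘ σ ∈ Δ}` with the angle weight: `[Δ, w]` re-indexed by `σ`. -/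
def orderCell (σ : Equiv.Perm (Fin 4)) : IntegralRep 4 := simplexPiece.reindex σ

/-- Membership in an order cell. -/
theorem mem_orderCell_domain {σ : Equiv.Perm (Fin 4)} {t : Fin 4 → ℝ} :
    t ∈ (orderCell σ).domain ↔ (fun i => t (σ i)) ∈ openOrderedSimplex 4 := Iff.rfl

/-- The integrand of an order cell is `w` (symmetry of `w`). -/
theorem orderCell_integrand (σ : Equiv.Perm (Fin 4)) (t : Fin 4 → ℝ) :
    (orderCell σ).integrand t = tanWeight t := by
  simp only [orderCell, IntegralRep.reindex_integrand, simplexPiece, anglePiece_integrand]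
  exact tanWeight_perm σ t

/-- Order cells lie in the box. -/
theorem orderCell_domain_subset (σ : Equiv.Perm (Fin 4)) : (orderCell σ).domain ⊆ kzOpenBox 4 := by
  intro t ht i
  obtain ⟨hp, hl, -⟩ := mem_orderCell_domain.mp ht
  simpa using And.intro (hp (σ.symm i)) (hl (σ.symm i))

/-- Distinct order cells are disjoint (a strictly decreasing rearrangement is unique). -/
theorem orderCell_domain_disjoint {σ τ : Equiv.Perm (Fin 4)} (h : σ ≠ τ) :
    (orderCell σ).domain ∩ (orderCell τ).domain = ∅ := by
  refine eq_empty_of_forall_notMem fun t ⟨hσ, hτ⟩ => h ?_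
  have h1 : StrictAnti (fun i => t (σ i)) := (mem_orderCell_domain.mp hσ).2.2
  have h2 : StrictAnti (fun i => t (τ i)) := (mem_orderCell_domain.mp hτ).2.2
  have hr : range (fun i => t (σ i)) = range (fun i => t (τ i)) := by
    rw [show (fun i => t (σ i)) = t ∘ σ from rfl, show (fun i => t (τ i)) = t ∘ τ from rfl,
      EquivLike.range_comp, EquivLike.range_comp]
  have heq := (h1.range_inj h2).mp hr
  refine Equiv.ext fun i => ?_
  have e1 : (fun j => t (σ j)) (σ.symm (τ i)) = (fun j => t (σ j)) i := by
    simp only [Equiv.apply_symm_apply]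
    exact (congrFun heq i).symm
  simpa using (congrArg σ (h1.injective e1)).symm

/-- A point of the box with distinct coordinates lies in an order cell (sort the coordinates). -/
theorem exists_mem_orderCell {t : Fin 4 → ℝ} (ht : t ∈ kzOpenBox 4) (hinj : Function.Injective t) :
    ∃ σ, t ∈ (orderCell σ).domain := by
  refine ⟨Fin.revPerm.trans (Tuple.sort t), mem_orderCell_domain.mpr
    ⟨fun i => (ht _).1, fun i => (ht _).2, fun a b hab => ?_⟩⟩
  have hmono : StrictMono (t ∘ Tuple.sort t) :=
    (Tuple.monotone_sort t).strictMono_of_injective (hinj.comp (Tuple.sort t).injective)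
  simp only [Equiv.trans_apply, Fin.revPerm_apply]
  exact hmono (Fin.rev_lt_rev.mpr hab)

/-- **Dissection (rule (1))**: `[(0,1)⁴, w] − Σ_σ [Δ_σ, w] ∈ relations`. -/
theorem angleBox_sub_sum_orderCell :
    of angleBox - ∑ σ ∈ (Finset.univ : Finset (Equiv.Perm (Fin 4))), of (orderCell σ) ∈
      relations := by
  refine of_sub_sum_of_mem_relations Finset.univ angleBox orderCell
    (fun σ _ => measure_mono_null
      (fun t ht => (ht.2 (angleBox_domain ▸ orderCell_domain_subset σ ht.1)).elim) measure_empty)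
    (fun σ _ t _ => by rw [orderCell_integrand, angleBox_integrand]) ?_
    (fun σ _ τ _ hστ => show volume ((orderCell σ).domain ∩ (orderCell τ).domain) = 0 by
      rw [orderCell_domain_disjoint hστ, measure_empty])
  refine measure_mono_null ?_
    (measure_iUnion_null_iff.mpr fun p : {p : Fin 4 × Fin 4 // p.1 ≠ p.2} =>
      Literature.Analysis.SpecialFunctions.Selberg.volume_setOf_apply_eq p.2)
  rintro t ⟨ht, hnot⟩
  rw [angleBox_domain] at ht
  simp only [Finset.mem_univ, iUnion_true, mem_iUnion, not_exists] at hnot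
  by_contra hties
  simp only [mem_iUnion, mem_setOf_eq, not_exists] at hties
  have hinj : Function.Injective t := fun i j hij => by
    by_contra hne
    exact hties ⟨(i, j), hne⟩ hij
  obtain ⟨σ, hσ⟩ := exists_mem_orderCell ht hinj
  exact hnot σ hσ

/-- Each order cell is a coordinate permutation of `[Δ, w]` (rule (2), linear chart). -/
theorem simplexPiece_sub_orderCell (σ : Equiv.Perm (Fin 4)) :
    of simplexPiece - of (orderCell σ) ∈ relations :=
  of_sub_of_reindex_mem_relations _ _

/-- **`[(0,1)⁴, w] = 24·[Δ, w]` in `Q`.** -/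
theorem mkQ_angleBox_eq : mkQ (of angleBox) = 24 • mkQ (of simplexPiece) := by
  have h1 := mkQ_eq_mkQ_iff.mpr angleBox_sub_sum_orderCell
  have h2 : ∑ σ ∈ (Finset.univ : Finset (Equiv.Perm (Fin 4))), of simplexPiece -
      ∑ σ ∈ (Finset.univ : Finset (Equiv.Perm (Fin 4))), of (orderCell σ) ∈ relations :=
    sum_sub_sum_mem_relations _ _ _ fun σ _ => simplexPiece_sub_orderCell σ
  have h3 := mkQ_eq_mkQ_iff.mpr h2
  have hcard : (Finset.univ : Finset (Equiv.Perm (Fin 4))).card = 24 := by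
    rw [Finset.card_univ, Fintype.card_perm, Fintype.card_fin]; rfl
  rw [h1, ← h3, Finset.sum_const, hcard, map_nsmul]

end SoloBlind

end Summit.KontsevichZagierPeriods.KontsevichZagierPeriods.Theorems
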